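import Summits.BirchSwinnertonDyer.BirchSwinnertonDyer.Theorems.Rank2ObservatoryRank3Table
import Summits.BirchSwinnertonDyer.BirchSwinnertonDyer.Theorems.Rank2ObservatoryRank3Rows01
import Summits.BirchSwinnertonDyer.BirchSwinnertonDyer.Theorems.Rank2ObservatoryRank3Rows02
import Summits.BirchSwinnertonDyer.BirchSwinnertonDyer.Theorems.Rank2ObservatoryRank3Rows03
import Summits.BirchSwinnertonDyer.BirchSwinnertonDyer.Theorems.Rank2ObservatoryRank3Rows04
import Summits.BirchSwinnertonDyer.BirchSwinnertonDyer.Theorems.Rank2ObservatoryRank3Rows05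
import Summits.BirchSwinnertonDyer.BirchSwinnertonDyer.Theorems.Rank2ObservatoryRank3Rows06
import Summits.BirchSwinnertonDyer.BirchSwinnertonDyer.Theorems.Rank2ObservatoryRank3Rows07
import Summits.BirchSwinnertonDyer.BirchSwinnertonDyer.Theorems.Rank2ObservatoryRank3Rows08
import Summits.BirchSwinnertonDyer.BirchSwinnertonDyer.Theorems.Rank2ObservatoryRank3Rows09
import Summits.BirchSwinnertonDyer.BirchSwinnertonDyer.Theorems.Rank2ObservatoryRank3Rows10
import Summits.BirchSwinnertonDyer.BirchSwinnertonDyer.Theorems.Rank2ObservatoryRank3Rows11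
import Summits.BirchSwinnertonDyer.BirchSwinnertonDyer.Theorems.Rank2ObservatoryRank3Rows12
import Summits.BirchSwinnertonDyer.BirchSwinnertonDyer.Theorems.Rank2ObservatoryRank3Rows13
import Summits.BirchSwinnertonDyer.BirchSwinnertonDyer.Theorems.Rank2ObservatoryRank3Rows14
import Summits.BirchSwinnertonDyer.BirchSwinnertonDyer.Theorems.Rank2ObservatoryRank3Rows15
import Summits.BirchSwinnertonDyer.BirchSwinnertonDyer.Theorems.Rank2ObservatoryRank3Rows16
import Summits.BirchSwinnertonDyer.BirchSwinnertonDyer.Theorems.Rank2ObservatoryRank3Rows17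
import Summits.BirchSwinnertonDyer.BirchSwinnertonDyer.Theorems.Rank2ObservatoryRank3Rows18
import Summits.BirchSwinnertonDyer.BirchSwinnertonDyer.Theorems.Rank2ObservatoryRank3Rows19
import Summits.BirchSwinnertonDyer.BirchSwinnertonDyer.Theorems.Rank2ObservatoryRank3Rows20
import Summits.BirchSwinnertonDyer.BirchSwinnertonDyer.Theorems.Rank2ObservatoryRank3Rows21
import Summits.BirchSwinnertonDyer.BirchSwinnertonDyer.Theorems.Rank2ObservatoryRank3Rows22
import Summits.BirchSwinnertonDyer.BirchSwinnertonDyer.Theorems.Rank2ObservatoryRank3Rows23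
import Summits.BirchSwinnertonDyer.BirchSwinnertonDyer.Theorems.Rank2ObservatoryRank3Rows24
import Summits.BirchSwinnertonDyer.BirchSwinnertonDyer.Theorems.Rank2ObservatoryRank3Rows25
import Summits.BirchSwinnertonDyer.BirchSwinnertonDyer.Theorems.Rank2ObservatoryRank3Rows26
import Summits.BirchSwinnertonDyer.BirchSwinnertonDyer.Theorems.Rank2ObservatoryRank3Rows27
import HarnessLib

/-!
# BirchSwinnertonDyer — rank ≥ 2 observatory: the rank-3 census (all 9487 curves, `N < 500 000`)

HONEST FRAMING: per-curve certified theorems and census instruments; no claim on BSD in rank ≥ 2.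

`rank3Table` is the concatenation of the 27 machine-written chunks
`Rank2ObservatoryRank3Rows01 … 27`: one `Rank3Row` per curve of (algebraic = analytic) rank `3`
and conductor `N < 500 000` in Cremona's table — `9487` curves in `8899` isogeny classes,
from `5077a1` to `499975a1`. THEOREMS (kernel-checked, no `native_decide`, axioms ⊆ the
gate whitelist):

* `rank3Table_check` — every row satisfies `Rank3Row.check` (assembled from the chunk theorems, each
  a `decide +kernel` evaluation): `Δ ≠ 0`, the three listed generators lie on the curve, the
  Kronecker condition of the Heegner hypothesis for `(N, D)`, `D < −4` of fundamental shape;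
* `rank3Table_length` — the table has `9487` rows; `rank3Table_conductor_lt` — every `N < 500 000`;
* `analyticRank_eq_rank_of_mem` — **for every curve `E` in the table, `r_an(E) = rank_ℤ E(ℚ)`**
  given, as NAMED HYPOTHESES, Gross–Zagier–Kolyvagin (`hGZK`, the tree's fact bsd.S17) and the
  row's four certificate fields `rank_lower` (`hlow : 3 ≤ rank`), `rank_upper` (`hup : rank ≤ 3`),
  `L3` (`hL3 : L‴(E,1) ≠ 0`) and `root_number` (`hw : w(E) = −1`) — the aggregated form of the
  per-curve kernel facts `analyticRank_eq_rank_<label>`; `analyticRank_eq_three_of_mem` likewise;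
* `rank3_lderiv_eq_zero_of_mem` — **for every curve in the table, `L′(E,1) = 0` EXACTLY** (REFEREE
  R1/R1.L shape: Gross–Zagier–Kolyvagin over `K = ℚ(√D)` with the row's `D`, in contrapositive;
  inputs modularity `hE`, the tree's GZK-over-`K` fact `hGZKK`, the minimal model of conductor `N`
  (`hmin`, `hN`), `K` imaginary quadratic with `disc K = D` (`hK`, `hdK`), `hlow`, `hw`, and the
  certified twist value `hLD : L(E^D,1) ≠ 0`); the Heegner hypothesis itself is DISCHARGED by
  `rank3Table_check`.

What remains a hypothesis and why (no descent, no reduction map `E(ℚ) → Ẽ(𝔽_q)`, analytic root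
number in Mathlib/the tree) is spelled out in `Rank2ObservatoryCertificate.lean`. Completeness of the
list ("every rank-3 curve of conductor `< 500 000`") is Cremona's table (DATA, not a theorem): the
`9487` labels are exactly the rank-3 rows of ecdata `allgens.00000-09999 … 490000-499999`.

DATA (provenance; recorded, not proved). Source table `rank3_table.tsv`, sha256
`7ea0aceeb8cb9d034ffa814bf86cb0c2a4ad120c6c62de60941b9d6307de97e2` (cell HOME
`run/shared/lean/b2b/bsd-rank2-observatory/b2b-bsdr2-cert-2/lean-census/`, with the generator
`gen_rank3_table.py`, which re-checks every row with the same predicate in Python and, independently,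
the Legendre symbols by Euler's criterion). Columns `label, a-invariants, N, generators` = Cremona's
ecdata; column `D` = field `claims.heegner_D` of the curve's engine-P rank-3 certificate (schema
`bsdr2-cert-2/v1`, all `9487` with `status = CERTIFIED`, `claims.referee_R1_shape = true`,
`claims.analytic_rank_eq_rank = true`; `D` odd for 8328 curves, even for 1159 — then the
Gross–Zagier step is Cai–Shu–Tian 2014 Thm. 1.1, REFEREE R13); column `s` = the generator's
square root of `D` modulo the odd part of `N` (Tonelli–Shanks + Hensel + CRT). Engine-P certificate
sets (cell seat cert-2; PARI/GP 2.17 + python-flint/Arb; one JSON per curve):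
* `R3-S1-j065398` (farm job `j065398`): 542 certificates read, `certs.sha256.json` sha256 `737b9ec900578166…`
* `R3-S2-j065411` (farm job `j065411`): 1571 certificates read, `certs.sha256.json` sha256 `c797a8c4ad088cf0…`
* `R3-S3-j065416` (farm job `j065416`): 2101 certificates read, `certs.sha256.json` sha256 `1e20a204a9c85dc6…`
* `R3-S4-j065423` (farm job `j065423`): 2465 certificates read, `certs.sha256.json` sha256 `eeaadb23a592a553…`
* `R3-S5-j065429` (farm job `j065429`): 2808 certificates read, `certs.sha256.json` sha256 `d40cf77b29ca4599…`
* `rerun2-j073225` (farm job `j073225`): 21 certificates read, `certs.sha256.json` sha256 `ba72d80e5cf80c79…`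
* `rerun3-j074334` (farm job `j074334`): 15 certificates read, `certs.sha256.json` sha256 `7f8aeb2f8d35c9cd…`
(a later directory supersedes an earlier one for the labels it contains: 34 labels). The second
engine (cell seat cert-3, Python standard library only) and the per-shard two-engine AGREEMENT
ledgers (`AGREEMENT-*.tsv`: root number, Heegner `D`, twist ball, `L‴/3!` ball, real period; any
disagreement is an ANOMALY UNDER VERIFICATION handled by the cell's referee, never a row here) live
under the same HOME; this file makes no claim about them.

References: J. E. Cremona, *Algorithms for Modular Elliptic Curves* (2nd ed. 1997), §2.13 and the
tables (ecdata); B. H. Gross, LMS LNS 153 (1991), (1.1) and Thm. 1.3; B. H. Gross, D. Zagier,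
Invent. Math. 84 (1986), Thm. I.(6.3); V. A. Kolyvagin, Progr. Math. 87 (1990), Thm. A; L. Cai,
J. Shu, Y. Tian, Algebra Number Theory 8 (2014), Thm. 1.1; J. P. Buhler, B. H. Gross, D. B. Zagier,
Math. Comp. 44 (1985) (`5077a1`).
-/

-- single-conjunct summit: `Summit.BirchSwinnertonDyer.BirchSwinnertonDyer.…` repeats the name by design
set_option linter.dupNamespace false

noncomputable section

open scoped Classical

namespace Summit.BirchSwinnertonDyer.BirchSwinnertonDyer.Rank2Observatory

open Literature Literature.NumberTheory.EllipticCurves WeierstrassCurve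

/-- **The rank-3 census table**: all `9487` curves of rank `3` and conductor `N < 500 000` in
Cremona's table, one `Rank3Row` each (chunks `rank3Rows01 … 27`; source `rank3_table.tsv`,
sha256 `7ea0aceeb8cb9d03…`). [cite: CremonaAlgorithms1997, Tables] -/
def rank3Table : List Rank3Row :=
  rank3Rows01 ++ rank3Rows02 ++ rank3Rows03 ++ rank3Rows04 ++ rank3Rows05 ++ rank3Rows06 ++
    rank3Rows07 ++ rank3Rows08 ++ rank3Rows09 ++ rank3Rows10 ++ rank3Rows11 ++ rank3Rows12 ++
    rank3Rows13 ++ rank3Rows14 ++ rank3Rows15 ++ rank3Rows16 ++ rank3Rows17 ++ rank3Rows18 ++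
    rank3Rows19 ++ rank3Rows20 ++ rank3Rows21 ++ rank3Rows22 ++ rank3Rows23 ++ rank3Rows24 ++
    rank3Rows25 ++ rank3Rows26 ++ rank3Rows27

/-- Every row of the census table satisfies the row predicate `Rank3Row.check` (the 27 chunk
theorems, each a kernel `decide`). [folklore] -/
theorem rank3Table_check : rank3Table.all Rank3Row.check = true := by
  simp only [rank3Table, List.all_append, Bool.and_eq_true]
  simp only [
    rank3Rows01_check, rank3Rows02_check, rank3Rows03_check, rank3Rows04_check,
    rank3Rows05_check, rank3Rows06_check, rank3Rows07_check, rank3Rows08_check,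
    rank3Rows09_check, rank3Rows10_check, rank3Rows11_check, rank3Rows12_check,
    rank3Rows13_check, rank3Rows14_check, rank3Rows15_check, rank3Rows16_check,
    rank3Rows17_check, rank3Rows18_check, rank3Rows19_check, rank3Rows20_check,
    rank3Rows21_check, rank3Rows22_check, rank3Rows23_check, rank3Rows24_check,
    rank3Rows25_check, rank3Rows26_check, rank3Rows27_check, and_self]

/-- The census table has `9487` rows (kernel count). [cite: CremonaAlgorithms1997, Tables] -/
theorem rank3Table_length : rank3Table.length = 9487 := by
  decide +kernel

/-- Every conductor in the census table is `< 500 000` (kernel). [cite: CremonaAlgorithms1997, Tables] -/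
theorem rank3Table_conductor_lt : rank3Table.all (fun r => decide (r.N < 500000)) = true := by
  decide +kernel

/-- A row of the census table checks. [folklore] -/
theorem check_of_mem {r : Rank3Row} (hr : r ∈ rank3Table) : r.check = true :=
  Rank3Row.check_of_all_check rank3Table_check hr

/-- Every curve of the census table is an elliptic curve (`Δ ≠ 0`, kernel). [folklore] -/
theorem isElliptic_of_mem {r : Rank3Row} (hr : r ∈ rank3Table) : r.curve.IsElliptic :=
  r.isElliptic_of_delta_ne_zero (r.check_spec (check_of_mem hr)).1

/-- **Aggregated weak BSD in rank 3, census form**: for every curve `E` of conductor `< 500 000` and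
rank `3` in the table, `r_an(E) = rank_ℤ E(ℚ)` — given Gross–Zagier–Kolyvagin (`hGZK`, bsd.S17) and
the curve's certificate fields `rank_lower`, `rank_upper`, `L3`, `root_number` as named hypotheses
(`Rank3Row.analyticRank_eq_rank`; table hash in the module docstring).
[cite: CremonaAlgorithms1997, §2.13] [cite: Darmon2004, Thm. 3.22] -/
theorem analyticRank_eq_rank_of_mem {r : Rank3Row} (hr : r ∈ rank3Table)
    (hGZK : rank_eq_analyticRank_of_analyticRank_le_one)
    (hlow : 3 ≤ r.curve.mordellWeilRank) (hup : r.curve.mordellWeilRank ≤ 3)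
    (hL3 : iteratedDeriv 3 r.curve.entireLFunction 1 ≠ 0) (hw : r.curve.rootNumber = -1) :
    r.curve.analyticRank = r.curve.mordellWeilRank :=
  r.analyticRank_eq_rank (check_of_mem hr) hGZK hlow hup hL3 hw

/-- Census form of `r_an(E) = 3`. [cite: CremonaAlgorithms1997, §2.13] -/
theorem analyticRank_eq_three_of_mem {r : Rank3Row} (hr : r ∈ rank3Table)
    (hGZK : rank_eq_analyticRank_of_analyticRank_le_one)
    (hlow : 3 ≤ r.curve.mordellWeilRank) (hup : r.curve.mordellWeilRank ≤ 3)
    (hL3 : iteratedDeriv 3 r.curve.entireLFunction 1 ≠ 0) (hw : r.curve.rootNumber = -1) :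
    r.curve.analyticRank = 3 :=
  r.analyticRank_eq_three (check_of_mem hr) hGZK hlow hup hL3 hw

/-- **Census form of the exact vanishing `L′(E,1) = 0`** (REFEREE R1/R1.L) for every curve of the
table, by Gross–Zagier–Kolyvagin over `K = ℚ(√D)` with the row's Heegner discriminant `D`; the
Heegner hypothesis for `(N, D)` is discharged by `rank3Table_check`.
[cite: GrossLMS1991, (1.1) and Thm. 1.3] [cite: Darmon2004, Hypothesis 3.9] -/
theorem rank3_lderiv_eq_zero_of_mem {r : Rank3Row} (hr : r ∈ rank3Table) (K : Type) [Field K]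
    [NumberField K] (hE : WeierstrassCurve.hasEntireLFunction_rat)
    (hGZKK : mordellWeilRank_eq_one_of_LDerivEK_ne_zero r.curve K)
    (hmin : r.curve.IsGloballyMinimal) (hN : r.curve.conductorNorm ℤ = r.N)
    (hK : IsImaginaryQuadratic K) (hdK : NumberField.discr K = r.D)
    (hlow : 3 ≤ r.curve.mordellWeilRank) (hw : r.curve.rootNumber = -1)
    (hLD : (r.curve.quadraticTwist (r.D : ℚ)).entireLFunction 1 ≠ 0) :
    deriv r.curve.entireLFunction 1 = 0 :=
  r.rank3_lderiv_eq_zero (check_of_mem hr) K hE hGZKK hmin hN hK hdK hlow hw hLD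

end Summit.BirchSwinnertonDyer.BirchSwinnertonDyer.Rank2Observatory

end
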